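import Mathlib.LinearAlgebra.Projectivization.Cardinality
import Mathlib.LinearAlgebra.Matrix.ToLin
import Mathlib.FieldTheory.Finiteness
import Mathlib.LinearAlgebra.FiniteDimensional.Basic
import HarnessLib

/-!
# Right ideals of a matrix ring over a field: `J ↦ column space`, and the `q + 1` right ideals
# of `M₂(𝔽_q)` with `q²` elements

Topic `NumberTheory/Automorphic` (support for the local theory of Brandt matrices: the `p + 1`
right ideals of reduced norm `p` of `M₂(ℤ_p)`, Eichler 1973, II §6 (16); Voight, *Quaternion
Algebras*, Ex. 26.6 / 26.4). Pure linear algebra over a field `F` (Morita theory for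
`M_n(F)`, made explicit):

* `rightIdealOf U = {A : A v ∈ U for all v}` — the right ideal of `M_n(F)` attached to a subspace
  `U ≤ Fⁿ` (matrices whose column space lies in `U`); right ideals are `(M_n F)ᵐᵒᵖ`-submodules of
  `M_n(F)`.
* `colSpan J` — the column space of a right ideal (span of all `A v`, `A ∈ J`).
* `rightIdealOf_colSpan`, `colSpan_rightIdealOf` — the two maps are inverse bijections
  (`rightIdealEquiv`): every right ideal of `M_n(F)` is `rightIdealOf U` for a unique `U`
  (a matrix with columns in the column space of `J` is a sum of rank-one matrices
  `(A v) ⊗ w = A (v ⊗ w) ∈ J`).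
* `leftAnnOf U = {A : A u = 0 for u ∈ U}` (a left ideal), `leftAnnOf_mul_rightIdealOf`
  (`K_U · J_U = 0`) and `exists_proj` (an `E ∈ J_U` with `1 - E ∈ K_U`: a projection onto `U`).
* cardinalities over a finite field with `q` elements: `|rightIdealOf U| = |U| ^ n`,
  `|J| = q ^ (n · dim colSpan J)`; for `n = 2` the right ideals with `q²` elements are exactly
  the `rightIdealOf L`, `L` a line, and there are `q + 1` of them
  (`card_rightIdeals_card_eq_sq`, via Mathlib's `Projectivization.card_of_finrank_two`).

Mathlib has two-sided ideals of matrix rings (`Ideal.matrix`, `TwoSidedIdeal.equivMatrix`) but not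
the one-sided correspondence; searched `rightIdeal`, `Submodule (Matrix _ _ _)ᵐᵒᵖ`, `colSpan`.

## References

* M. Eichler, *The basis problem for modular forms and the traces of the Hecke operators*,
  LNM 320 (1973), Ch. II §6 [Eichler1973].
* J. Voight, *Quaternion Algebras*, GTM 288 (2021), §7.2 (matrix rings), §26.4 [Voight2021].
-/

open scoped Matrix

namespace Literature.NumberTheory.Automorphic

namespace MatrixRightIdeal

variable {F : Type*} [Field F] {n : Type*} [Fintype n] [DecidableEq n]

/-! ### The right ideal of a subspace and the column space of a right ideal -/

variable (n) in
/-- The right ideal `J_U = {A ∈ M_n(F) : A v ∈ U for all v ∈ Fⁿ}` of matrices whose column space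
lies in the subspace `U` (a right ideal: `(A X) v = A (X v)`), as an `(M_n F)ᵐᵒᵖ`-submodule of
`M_n(F)`. [folklore] -/
def rightIdealOf (U : Submodule F (n → F)) : Submodule (Matrix n n F)ᵐᵒᵖ (Matrix n n F) where
  carrier := {A | ∀ v, A *ᵥ v ∈ U}
  add_mem' {A B} hA hB v := by rw [Matrix.add_mulVec]; exact U.add_mem (hA v) (hB v)
  zero_mem' v := by rw [Matrix.zero_mulVec]; exact U.zero_mem
  smul_mem' X {A} hA v := by
    rw [MulOpposite.smul_eq_mul_unop]
    change (A * X.unop) *ᵥ v ∈ U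
    rw [← Matrix.mulVec_mulVec]
    exact hA _

/-- Membership in `J_U` (definitional). [folklore] -/
theorem mem_rightIdealOf_iff {U : Submodule F (n → F)} {A : Matrix n n F} :
    A ∈ rightIdealOf n U ↔ ∀ v, A *ᵥ v ∈ U := Iff.rfl

/-- `A ∈ J_U` iff every column of `A` lies in `U`. [folklore] -/
theorem mem_rightIdealOf_iff_col {U : Submodule F (n → F)} {A : Matrix n n F} :
    A ∈ rightIdealOf n U ↔ ∀ j, A.col j ∈ U := by
  refine ⟨fun h j => by rw [← Matrix.mulVec_single_one]; exact h _, fun h v => ?_⟩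
  have hv : v = ∑ j, v j • (Pi.single j 1 : n → F) := by
    ext i; simp [Finset.sum_apply, Pi.single_apply]
  rw [hv, Matrix.mulVec_sum]
  refine U.sum_mem fun j _ => ?_
  rw [Matrix.mulVec_smul, Matrix.mulVec_single_one]
  exact U.smul_mem _ (h j)

/-- The **column space** of a right ideal `J`: the span of all `A v`, `A ∈ J`, `v ∈ Fⁿ`. [folklore] -/
def colSpan (J : Submodule (Matrix n n F)ᵐᵒᵖ (Matrix n n F)) : Submodule F (n → F) :=
  Submodule.span F {w | ∃ A ∈ J, ∃ v, A *ᵥ v = w}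

/-- `A v` lies in the column space of any right ideal containing `A`. [folklore] -/
theorem mulVec_mem_colSpan {J : Submodule (Matrix n n F)ᵐᵒᵖ (Matrix n n F)} {A : Matrix n n F}
    (hA : A ∈ J) (v : n → F) : A *ᵥ v ∈ colSpan J :=
  Submodule.subset_span ⟨A, hA, v, rfl⟩

/-- A right ideal of `M_n(F)` is an `F`-subspace: `c A = A (c 1) ∈ J`. [folklore] -/
theorem smul_mem {J : Submodule (Matrix n n F)ᵐᵒᵖ (Matrix n n F)} {A : Matrix n n F} (hA : A ∈ J)
    (c : F) : c • A ∈ J := by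
  have h := J.smul_mem (MulOpposite.op (c • (1 : Matrix n n F))) hA
  rwa [MulOpposite.smul_eq_mul_unop, MulOpposite.unop_op, Matrix.mul_smul, mul_one] at h

/-- Rank-one matrices `(A v) ⊗ w = A · (v ⊗ w)` lie in any right ideal containing `A`. [folklore] -/
theorem vecMulVec_mulVec_mem {J : Submodule (Matrix n n F)ᵐᵒᵖ (Matrix n n F)} {A : Matrix n n F}
    (hA : A ∈ J) (v w : n → F) : Matrix.vecMulVec (A *ᵥ v) w ∈ J := by
  rw [← Matrix.mul_vecMulVec]
  have h := J.smul_mem (MulOpposite.op (Matrix.vecMulVec v w)) hA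
  rwa [MulOpposite.smul_eq_mul_unop, MulOpposite.unop_op] at h

/-- For `u` in the column space of `J`, every rank-one matrix `u ⊗ w` lies in `J`. [folklore] -/
theorem vecMulVec_mem_of_mem_colSpan {J : Submodule (Matrix n n F)ᵐᵒᵖ (Matrix n n F)} {u : n → F}
    (hu : u ∈ colSpan J) (w : n → F) : Matrix.vecMulVec u w ∈ J := by
  induction hu using Submodule.span_induction with
  | mem x hx =>
    obtain ⟨A, hA, v, rfl⟩ := hx
    exact vecMulVec_mulVec_mem hA v w
  | zero =>
    have : Matrix.vecMulVec (0 : n → F) w = 0 := by ext i j; simp [Matrix.vecMulVec_apply]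
    rw [this]; exact J.zero_mem
  | add x y _ _ hx hy => rw [Matrix.add_vecMulVec]; exact J.add_mem hx hy
  | smul c x _ hx => rw [Matrix.smul_vecMulVec]; exact smul_mem hx c

/-- A matrix is the sum of the rank-one matrices `(col_j A) ⊗ e_j`. [folklore] -/
theorem sum_vecMulVec_col_single (A : Matrix n n F) :
    ∑ j, Matrix.vecMulVec (A.col j) (Pi.single j 1) = A := by
  ext i k
  simp [Matrix.sum_apply, Matrix.vecMulVec_apply, Pi.single_apply]

/-- **Every right ideal is determined by its column space**: `J = J_{colSpan J}`. [folklore] -/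
theorem rightIdealOf_colSpan (J : Submodule (Matrix n n F)ᵐᵒᵖ (Matrix n n F)) :
    rightIdealOf n (colSpan J) = J := by
  refine le_antisymm (fun A hA => ?_) (fun A hA v => mulVec_mem_colSpan hA v)
  rw [← sum_vecMulVec_col_single A]
  refine J.sum_mem fun j _ => vecMulVec_mem_of_mem_colSpan ?_ _
  exact (mem_rightIdealOf_iff_col.mp hA) j

/-- The column space of `J_U` is `U`. [folklore] -/
theorem colSpan_rightIdealOf (U : Submodule F (n → F)) : colSpan (rightIdealOf n U) = U := by
  refine le_antisymm (Submodule.span_le.mpr ?_) fun u hu => ?_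
  · rintro w ⟨A, hA, v, rfl⟩
    exact hA v
  · rcases isEmpty_or_nonempty n with hn | ⟨⟨j⟩⟩
    · have : u = 0 := funext fun i => (hn.false i).elim
      rw [this]; exact (colSpan _).zero_mem
    · have hmem : Matrix.vecMulVec u (Pi.single j (1 : F)) ∈ rightIdealOf n U := fun v => by
        rw [Matrix.vecMulVec_mulVec, IsCentralScalar.op_smul_eq_smul]
        exact U.smul_mem _ hu
      have h := mulVec_mem_colSpan hmem (Pi.single j 1)
      have hu' : Matrix.vecMulVec u (Pi.single j (1 : F)) *ᵥ Pi.single j 1 = u := by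
        ext i
        simp [Matrix.mulVec, dotProduct, Matrix.vecMulVec_apply, Pi.single_apply]
      rwa [hu'] at h

variable (F n) in
/-- **Right ideals of `M_n(F)` ↔ subspaces of `Fⁿ`** (`U ↦ J_U`, inverse `J ↦ colSpan J`).
[folklore] -/
def rightIdealEquiv : Submodule F (n → F) ≃ Submodule (Matrix n n F)ᵐᵒᵖ (Matrix n n F) where
  toFun := rightIdealOf n
  invFun := colSpan
  left_inv := colSpan_rightIdealOf
  right_inv := rightIdealOf_colSpan

/-- `rightIdealOf` is injective. [folklore] -/
theorem rightIdealOf_injective : Function.Injective (rightIdealOf (F := F) n) :=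
  (rightIdealEquiv F n).injective

/-- `J_⊤ = M_n(F)`. [folklore] -/
theorem rightIdealOf_top : rightIdealOf n (⊤ : Submodule F (n → F)) = ⊤ :=
  eq_top_iff.mpr fun _ _ _ => Submodule.mem_top

/-- `1 ∈ J_U ↔ U = ⊤`. [folklore] -/
theorem one_mem_rightIdealOf_iff {U : Submodule F (n → F)} :
    (1 : Matrix n n F) ∈ rightIdealOf n U ↔ U = ⊤ := by
  refine ⟨fun h => eq_top_iff.mpr fun v _ => ?_, fun h => ?_⟩
  · have := h v
    rwa [Matrix.one_mulVec] at this
  · rw [h, rightIdealOf_top]; exact Submodule.mem_top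

/-! ### The left annihilator of a subspace and projections -/

variable (n) in
/-- The left ideal `K_U = {A : A u = 0 for all u ∈ U}` of `M_n(F)` (matrices killing `U`). [folklore] -/
def leftAnnOf (U : Submodule F (n → F)) : Submodule (Matrix n n F) (Matrix n n F) where
  carrier := {A | ∀ u ∈ U, A *ᵥ u = 0}
  add_mem' {A B} hA hB u hu := by rw [Matrix.add_mulVec, hA u hu, hB u hu, add_zero]
  zero_mem' u _ := Matrix.zero_mulVec u
  smul_mem' X {A} hA u hu := by
    change (X * A) *ᵥ u = 0
    rw [← Matrix.mulVec_mulVec, hA u hu, Matrix.mulVec_zero]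

/-- Membership in `K_U` (definitional). [folklore] -/
theorem mem_leftAnnOf_iff {U : Submodule F (n → F)} {A : Matrix n n F} :
    A ∈ leftAnnOf n U ↔ ∀ u ∈ U, A *ᵥ u = 0 := Iff.rfl

/-- A matrix is determined by its action on vectors. [folklore] -/
theorem eq_of_forall_mulVec_eq {A B : Matrix n n F} (h : ∀ v, A *ᵥ v = B *ᵥ v) : A = B := by
  ext i j
  have := congrFun (h (Pi.single j 1)) i
  rwa [Matrix.mulVec_single_one, Matrix.mulVec_single_one] at this

/-- **`K_U · J_U = 0`**: a matrix killing `U` times a matrix with columns in `U` is zero. [folklore] -/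
theorem mul_eq_zero_of_mem {U : Submodule F (n → F)} {A B : Matrix n n F} (hA : A ∈ leftAnnOf n U)
    (hB : B ∈ rightIdealOf n U) : A * B = 0 :=
  eq_of_forall_mulVec_eq fun v => by
    rw [← Matrix.mulVec_mulVec, hA _ (hB v), Matrix.zero_mulVec]

/-- **A projection onto `U`**: there is `E ∈ J_U` with `1 - E ∈ K_U` (the matrix of a linear
projection of `Fⁿ` onto `U` along a complement). [folklore] -/
theorem exists_proj (U : Submodule F (n → F)) :
    ∃ E : Matrix n n F, E ∈ rightIdealOf n U ∧ 1 - E ∈ leftAnnOf n U := by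
  obtain ⟨W, hW⟩ := U.exists_isCompl
  refine ⟨LinearMap.toMatrix' (U.projection W hW), fun v => ?_, fun u hu => ?_⟩
  · rw [← Matrix.toLin'_apply, Matrix.toLin'_toMatrix']
    exact Submodule.projection_apply_mem hW v
  · rw [Matrix.sub_mulVec, Matrix.one_mulVec, ← Matrix.toLin'_apply, Matrix.toLin'_toMatrix',
      sub_eq_zero]
    exact (Submodule.projection_apply_left hW ⟨u, hu⟩).symm

/-! ### Cardinalities -/

/-- `J_U ≃ Uⁿ` (a matrix with columns in `U` is an `n`-tuple of columns). [folklore] -/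
def rightIdealOfEquivFun (U : Submodule F (n → F)) : rightIdealOf n U ≃ (n → U) where
  toFun A := fun j => ⟨(A : Matrix n n F).col j, (mem_rightIdealOf_iff_col.mp A.2) j⟩
  invFun c := ⟨Matrix.of fun i j => (c j : n → F) i,
    mem_rightIdealOf_iff_col.mpr fun j => by
      have hc : (Matrix.of fun i j => (c j : n → F) i).col j = (c j : n → F) := funext fun _ => rfl
      rw [hc]; exact (c j).2⟩
  left_inv A := by
    apply Subtype.ext
    ext i j; rfl
  right_inv c := by
    funext j
    apply Subtype.ext
    rfl

/-- `|J_U| = |U| ^ n`. [folklore] -/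
theorem natCard_rightIdealOf (U : Submodule F (n → F)) :
    Nat.card (rightIdealOf n U) = Nat.card U ^ Fintype.card n := by
  rw [Nat.card_congr (rightIdealOfEquivFun U), Nat.card_fun, Nat.card_eq_fintype_card (α := n)]

section Finite

variable [Fintype F]

omit [DecidableEq n] in
/-- Over a finite field with `q` elements, `|U| = q ^ dim U`. [folklore] -/
theorem natCard_submodule_eq_pow (U : Submodule F (n → F)) :
    Nat.card U = Fintype.card F ^ Module.finrank F U := by
  classical
  letI : Fintype U := Fintype.ofFinite U
  rw [Nat.card_eq_fintype_card, Module.card_eq_pow_finrank (K := F) (V := U)]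

/-- Over a finite field with `q` elements, `|J| = q ^ (n · dim colSpan J)` for every right ideal
`J` of `M_n(F)`. [folklore] -/
theorem natCard_eq_pow_mul_finrank_colSpan (J : Submodule (Matrix n n F)ᵐᵒᵖ (Matrix n n F)) :
    Nat.card J = Fintype.card F ^ (Fintype.card n * Module.finrank F (colSpan J)) := by
  conv_lhs => rw [← rightIdealOf_colSpan J]
  rw [natCard_rightIdealOf, natCard_submodule_eq_pow, ← pow_mul, mul_comm]

omit [Fintype F] in
/-- The exponent is bounded: `dim colSpan J ≤ n`. [folklore] -/
theorem finrank_colSpan_le (J : Submodule (Matrix n n F)ᵐᵒᵖ (Matrix n n F)) :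
    Module.finrank F (colSpan J) ≤ Fintype.card n := by
  have h := Submodule.finrank_le (colSpan J)
  rwa [Module.finrank_fintype_fun_eq_card] at h

/-- For `2 × 2` matrices: `|J| = q²` iff the column space of `J` is a line. [folklore] -/
theorem natCard_eq_sq_iff (hn : Fintype.card n = 2) (J : Submodule (Matrix n n F)ᵐᵒᵖ (Matrix n n F)) :
    Nat.card J = Fintype.card F ^ 2 ↔ Module.finrank F (colSpan J) = 1 := by
  rw [natCard_eq_pow_mul_finrank_colSpan, hn]
  constructor
  · intro h
    have := Nat.pow_right_injective (Fintype.one_lt_card (α := F)) h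
    omega
  · intro h; rw [h]

omit [DecidableEq n] in
/-- There are `q + 1` lines in `𝔽_q²` (points of `ℙ¹(𝔽_q)`, Mathlib
`Projectivization.card_of_finrank_two`), here for any two-element coordinate type `n`. [folklore] -/
theorem natCard_lines (hn : Fintype.card n = 2) :
    Nat.card {U : Submodule F (n → F) // Module.finrank F U = 1} = Fintype.card F + 1 := by
  rw [← Nat.card_congr (Projectivization.equivSubmodule F (n → F)),
    Projectivization.card_of_finrank_two F (n → F)
      (by rw [Module.finrank_fintype_fun_eq_card, hn]),
    Nat.card_eq_fintype_card]

/-- **The right ideals of `M₂(𝔽_q)` with `q²` elements are the `J_L`, `L` a line, and there are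
`q + 1` of them** (as many as points of `ℙ¹(𝔽_q)`; Mathlib `Projectivization.card_of_finrank_two`).
These are the reductions of the `q + 1` right ideals of norm `q` of `M₂(ℤ_q)` (Eichler 1973, II §6
(16)). [folklore] -/
theorem natCard_rightIdeals_card_eq_sq (hn : Fintype.card n = 2) :
    Nat.card {J : Submodule (Matrix n n F)ᵐᵒᵖ (Matrix n n F) // Nat.card J = Fintype.card F ^ 2} =
      Fintype.card F + 1 := by
  have e1 : {J : Submodule (Matrix n n F)ᵐᵒᵖ (Matrix n n F) // Nat.card J = Fintype.card F ^ 2} ≃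
      {U : Submodule F (n → F) // Module.finrank F U = 1} :=
    { toFun := fun J => ⟨colSpan J.1, (natCard_eq_sq_iff hn J.1).mp J.2⟩
      invFun := fun U => ⟨rightIdealOf n U.1, by
        rw [natCard_eq_sq_iff hn, colSpan_rightIdealOf]; exact U.2⟩
      left_inv := fun J => Subtype.ext (rightIdealOf_colSpan J.1)
      right_inv := fun U => Subtype.ext (colSpan_rightIdealOf U.1) }
  rw [Nat.card_congr e1, natCard_lines hn]

end Finite

end MatrixRightIdeal

end Literature.NumberTheory.Automorphic
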